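import Literature.Computability.Complexity.ACRealize
import HarnessLib

/-!
# Locally consistent gate values are the true gate values

Literature / circuit complexity toolkit. The verification step shared by Williams' Lemma 3.1
(J. ACM 2014, pp. 10–12: a guessed circuit claiming the value of every gate of a uniform
circuit is checked by a SAT call on the circuit expressing "some gate is inconsistent with its
inputs") and by Murray–Williams' simulation (STOC 2018, §5, the task `EVAL-GATE` and the circuit
`D`: "It is easy to see that `D(x) = 0` if and only if `E` is consistent for all gates of
`C_n^{W_n}` on the input `x` … From this, we have the consistency condition: for all `x`,
`D(x) = 0` implies that `E(C_n^O, W_n, x, s) = C_n^{W_n}(x)`") rests on one fact about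
straight-line circuits: a list of CLAIMED gate values that satisfies every gate equation
(each claimed value is the gate function applied to the claimed values of its argument wires)
IS the list of true gate values — by induction along the program order, the program being
acyclic. This file proves it for the tree's gate lists (`GateList.vals`,
`CircuitComposition.lean`) and circuits:

* **`GateList.vals_eq_of_consistent`** — soundness of the consistency check: a claimed value
  list of the right length satisfying all gate equations of a well-formed gate list equals
  `vals gs x`; `GateList.wireOf_eq_of_consistent`, **`Circuit.eval_eq_of_consistent`** — hence
  every wire, in particular the output, carries the claimed value;
* **`GateList.vals_consistent`** — completeness: the true values satisfy the gate equations
  (so the honest claim passes the check); `Circuit.wireVals_consistent`.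

No notion, definition or named fact is introduced (theorems only; the consistency condition is
spelled out in the hypotheses).

## References

* R. Williams, *Nonuniform ACC circuit lower bounds*, J. ACM 61 (2014), Lemma 3.1 (proof,
  pp. 10–12: the circuits VALUE and EQUIV) [Williams2014].
* C. D. Murray, R. R. Williams, *Circuit lower bounds for nondeterministic quasi-polytime: an easy
  witness lemma for NP and NQP*, STOC 2018, §5 (`EVAL-GATE`, the consistency condition (6))
  [MurrayWilliams2018].
* S. Arora, B. Barak, *Computational Complexity: A Modern Approach*, CUP 2009, Rem. 6.4
  (straight-line programs) [AroraBarak2009].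
-/

namespace Literature.Computability.Complexity

namespace GateList

variable {ι : Type*}

/-- A wire into the first `j` gates of a program keeps its value when gate values beyond
position `j ≤ |vs|` are changed or appended. [folklore] -/
theorem wireOf_append_eq_of_gateOK (x : ι → Bool) (vs ws : List Bool) {j : ℕ} (g : Gate ι)
    (hg : GateOK j g) (hj : j ≤ vs.length) (a : Fin g.arity) :
    wireOf x (vs ++ ws) (g.args a) = wireOf x vs (g.args a) :=
  wireOf_append_of_lt x vs ws (g.args a) fun m hm => (hg a m hm).trans_le hj

/-- **Soundness of the gate-consistency check.** Let `gs` be a well-formed gate list and `vs` a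
list of claimed gate values, one per gate, such that every claimed value is the gate function
applied to the values its argument wires carry under the claim
(`vs[j] = gⱼ.op (a ↦ wireOf x vs (gⱼ.args a))`). Then `vs` is the list of true gate values
`vals gs x` (induction along the program: the arguments of gate `j` are inputs or gates `< j`).
(Williams 2014, proof of Lemma 3.1; Murray–Williams 2018, §5, consistency condition (6).)
[cite: MurrayWilliams2018, §5 (proof of Thm. 1.1)] -/
theorem vals_eq_of_consistent (gs : List (Gate ι)) (hwf : WF gs) (x : ι → Bool) (vs : List Bool)
    (hlen : vs.length = gs.length)
    (hcons : ∀ (j : ℕ) (g : Gate ι), gs[j]? = some g →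
      vs[j]? = some (g.op fun a => wireOf x vs (g.args a))) :
    vs = vals gs x := by
  induction gs using List.reverseRecOn generalizing vs with
  | nil => simpa using hlen
  | append_singleton gs g ih =>
    -- split the claim into the claims for `gs` and the claim for the last gate
    rcases List.eq_nil_or_concat vs with rfl | ⟨vs', b, rfl⟩
    · simp at hlen
    simp only [List.concat_eq_append] at hlen hcons ⊢
    simp only [List.length_append, List.length_singleton, Nat.add_right_cancel_iff] at hlen
    have hwf' : WF gs := hwf.of_append_left
    have hlast : GateOK gs.length g := hwf.getLast
    -- the claims for `gs` are consistent on their own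
    have hcons' : ∀ (j : ℕ) (g' : Gate ι), gs[j]? = some g' →
        vs'[j]? = some (g'.op fun a => wireOf x vs' (g'.args a)) := by
      intro j g' hj
      have hjl : j < gs.length := (List.getElem?_eq_some_iff.1 hj).1
      have h := hcons j g' (by rw [List.getElem?_append_left hjl]; exact hj)
      rw [List.getElem?_append_left (by omega)] at h
      rw [h]
      congr 1
      exact congrArg g'.op (funext fun a =>
        wireOf_append_eq_of_gateOK x vs' [b] g' (hwf' j g' hj) (by omega) a)
    have ih' := ih hwf' vs' hlen hcons'
    -- the last claim is the value of the last gate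
    have hb := hcons gs.length g (by simp)
    rw [List.getElem?_append_right (by omega), hlen, Nat.sub_self,
      List.getElem?_cons_zero, Option.some.injEq] at hb
    rw [vals_append_singleton, ← ih', hb]
    congr 2
    exact congrArg g.op (funext fun a =>
      wireOf_append_eq_of_gateOK x vs' [b] g hlast (by omega) a)

/-- Under a consistent claim every wire carries its true value. [cite: MurrayWilliams2018, §5 (proof of Thm. 1.1)] -/
theorem wireOf_eq_of_consistent (gs : List (Gate ι)) (hwf : WF gs) (x : ι → Bool) (vs : List Bool)
    (hlen : vs.length = gs.length)
    (hcons : ∀ (j : ℕ) (g : Gate ι), gs[j]? = some g →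
      vs[j]? = some (g.op fun a => wireOf x vs (g.args a))) (w : ι ⊕ ℕ) :
    wireOf x vs w = wireOf x (vals gs x) w := by
  rw [vals_eq_of_consistent gs hwf x vs hlen hcons]

/-- **Completeness of the gate-consistency check**: the true gate values of a well-formed gate
list satisfy every gate equation. [cite: MurrayWilliams2018, §5 (proof of Thm. 1.1)] -/
theorem vals_consistent (gs : List (Gate ι)) (hwf : WF gs) (x : ι → Bool) (j : ℕ) (g : Gate ι)
    (hj : gs[j]? = some g) :
    (vals gs x)[j]? = some (g.op fun a => wireOf x (vals gs x) (g.args a)) := by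
  induction gs using List.reverseRecOn with
  | nil => simp at hj
  | append_singleton gs g' ih =>
    have hwf' : WF gs := hwf.of_append_left
    rw [vals_append_singleton]
    by_cases hjl : j < gs.length
    · rw [List.getElem?_append_left hjl] at hj
      rw [List.getElem?_append_left (by simpa using hjl), ih hwf' hj]
      congr 1
      exact congrArg g.op (funext fun a =>
        (wireOf_append_eq_of_gateOK x (vals gs x) _ g (hwf' j g hj) (by simp; omega) a).symm)
    · have hjeq : j = gs.length := by
        have := (List.getElem?_eq_some_iff.1 hj).1
        simp only [List.length_append, List.length_singleton] at this
        omega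
      subst hjeq
      have hg : g' = g := by
        rw [List.getElem?_append_right le_rfl, Nat.sub_self] at hj
        simpa using hj
      subst hg
      rw [List.getElem?_append_right (by simp), length_vals, Nat.sub_self,
        List.getElem?_cons_zero]
      simp only [Option.some.injEq]
      exact congrArg g'.op (funext fun a =>
        (wireOf_append_eq_of_gateOK x (vals gs x) _ g' hwf.getLast (by simp) a).symm)

end GateList

namespace Circuit

open GateList

variable {ι : Type*}

/-- **A circuit evaluates to the claimed output value under a consistent claim** of all its
gate values (`GateList.vals_eq_of_consistent` and `circuit_eval`): the "consistency condition"
of the easy-witness simulations. [cite: MurrayWilliams2018, §5 (proof of Thm. 1.1)] -/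
theorem eval_eq_of_consistent (C : Circuit ι) (x : ι → Bool) (vs : List Bool)
    (hlen : vs.length = C.size)
    (hcons : ∀ (j : ℕ) (g : Gate ι), C.gates[j]? = some g →
      vs[j]? = some (g.op fun a => wireOf x vs (g.args a))) :
    C.eval x = wireOf x vs C.output := by
  rw [circuit_eval, vals_eq_of_consistent C.gates (wf_gates C) x vs hlen hcons]

/-- The true gate values of a circuit (`Circuit.wireVals = GateList.vals`) satisfy every gate
equation. [cite: MurrayWilliams2018, §5 (proof of Thm. 1.1)] -/
theorem wireVals_consistent (C : Circuit ι) (x : ι → Bool) (j : ℕ) (g : Gate ι)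
    (hj : C.gates[j]? = some g) :
    (C.wireVals x)[j]? = some (g.op fun a => wireOf x (C.wireVals x) (g.args a)) := by
  rw [circuit_wireVals]
  exact vals_consistent C.gates (wf_gates C) x j g hj

end Circuit

end Literature.Computability.Complexity
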